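import Summits.SmoothPoincare4.SmoothPoincare4.Theorems.AgkCor6Sufficiency.Negative.StablyTrivialTight

/-!
# `AgkCor6Sufficiency` — negative-side support II: the balance `g = 3k` is load-bearing

Companion of `StablyTrivialTight.lean` (crux item `stmt-SmoothPoincare4-10894`, work file
`Cruxes/AgkCor6Sufficiency/Disproof.lean` §5).  `cp2Kernels` — the genus-one `(1,0)` trisection of
`ℂP²` (`⟪a⟫, ⟪b⟫, ⟪ab⟫`: the curves of slope `0, ∞, 1` on the torus) — is a `(1,0)` group
trisection of the trivial group (`cp2Kernels_isGroupTrisection`) and is NOT stably trivial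
(`not_isStablyTrivial_cp2Kernels`, by `isStablyTrivial_tight`: `1 ≠ 3·0`).  Hence
`not_forall_isGroupTrisection_punit_isStablyTrivial`: AGK's hypothesis with the balance condition
`g = 3k` dropped is false — no attack on it may be insensitive to `χ = 2 + g - 3k`.

References: A. Abrams, D. Gay, R. Kirby, *Group trisections and smooth 4-manifolds*, Geom. Topol.
22 (2018), Def. 1–3, Thm. 5, Cor. 6 (p. 1541); D. Gay, R. Kirby, *Trisecting 4-manifolds*, Geom.
Topol. 20 (2016), §2 (genus-one trisections of `ℂP²`, `S¹ × S³`; connected sums).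
-/

noncomputable section

namespace Summit.SmoothPoincare4.SmoothPoincare4.Theorems.AgkCor6Sufficiency.Negative

open Literature.Topology.FourManifolds Subgroup

/-! ## 5. Refuted strengthening I: the balance condition `g = 3k` is load-bearing
(`ℂP²`'s genus-one `(1, 0)` trisection of the trivial group is not stably trivial) -/

section CP2

/-- The generator `a` of `S_1 = ⟨a, b ∣ [a,b]⟩ ≅ ℤ²`. [folklore] -/
abbrev ta : SurfaceGroup 1 := PresentedGroup.of (0, false)
/-- The generator `b` of `S_1`. [folklore] -/
abbrev tb : SurfaceGroup 1 := PresentedGroup.of (0, true)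

/-- The kernel triple of the genus-`1` `(1; 0,0,0)` trisection of `ℂP²`: `⟪a⟫, ⟪b⟫, ⟪ab⟫` (the
curves of slope `0`, `∞`, `1` on the torus; Gay–Kirby 2016, §2). [folklore] -/
def cp2Kernels : TrisectionKernels 1 :=
  ![normalClosure {ta}, normalClosure {tb}, normalClosure {ta * tb}]

/-- The first kernel `⟪a⟫`. [folklore] -/
theorem cp2Kernels_zero : cp2Kernels 0 = normalClosure {ta} := rfl
/-- The second kernel `⟪b⟫`. [folklore] -/
theorem cp2Kernels_one : cp2Kernels 1 = normalClosure {tb} := rfl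
/-- The third kernel `⟪ab⟫`. [folklore] -/
theorem cp2Kernels_two : cp2Kernels 2 = normalClosure {ta * tb} := rfl

/-- The kernels are normal closures, hence normal. [folklore] -/
instance cp2Kernels_normal (i : Fin 3) : (cp2Kernels i).Normal := by
  fin_cases i <;> simp [cp2Kernels] <;> infer_instance

/-- `a ∈ ⟪a⟫`. [folklore] -/
theorem ta_mem : ta ∈ cp2Kernels 0 := subset_normalClosure rfl
/-- `b ∈ ⟪b⟫`. [folklore] -/
theorem tb_mem : tb ∈ cp2Kernels 1 := subset_normalClosure rfl
/-- `ab ∈ ⟪ab⟫`. [folklore] -/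
theorem tab_mem : ta * tb ∈ cp2Kernels 2 := subset_normalClosure rfl

/-- `S_1 / ⟪a⟫ ≅ F_1` (the survivor is `b`). [folklore] -/
theorem isFreeOfRank_quotient_cp2Kernels_zero : IsFreeOfRank (SurfaceGroup 1 ⧸ cp2Kernels 0) 1 := by
  refine isFreeOfRank_quotient_of_erase (n := 1) {((0 : Fin 1), false)} (fun i => ?_) _ ?_ ?_ (by decide)
  · left; obtain rfl : i = 0 := Subsingleton.elim _ _; simp
  · intro x hx
    rw [Finset.mem_singleton] at hx
    subst hx
    exact ta_mem
  · rw [cp2Kernels_zero]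
    exact normalClosure_le_normal (Set.singleton_subset_iff.2
      (of_mem_ker_eraseHom _ _ (Finset.mem_singleton_self _)))

/-- `S_1 / ⟪b⟫ ≅ F_1` (the survivor is `a`). [folklore] -/
theorem isFreeOfRank_quotient_cp2Kernels_one : IsFreeOfRank (SurfaceGroup 1 ⧸ cp2Kernels 1) 1 := by
  refine isFreeOfRank_quotient_of_erase (n := 1) {((0 : Fin 1), true)} (fun i => ?_) _ ?_ ?_ (by decide)
  · right; obtain rfl : i = 0 := Subsingleton.elim _ _; simp
  · intro x hx
    rw [Finset.mem_singleton] at hx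
    subst hx
    exact tb_mem
  · rw [cp2Kernels_one]
    exact normalClosure_le_normal (Set.singleton_subset_iff.2
      (of_mem_ker_eraseHom _ _ (Finset.mem_singleton_self _)))

/-- The hom `S_1 → F_1`, `a ↦ x`, `b ↦ x⁻¹`, killing `ab` (and the relator `[a,b] ↦ [x,x⁻¹] = 1`). [folklore] -/
def cp2HomTwo : SurfaceGroup 1 →* FreeGroup (Fin 1) :=
  PresentedGroup.toGroup (f := fun p => if p.2 then (FreeGroup.of 0)⁻¹ else FreeGroup.of 0) (by
    intro r hr
    rw [Set.mem_singleton_iff] at hr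
    subst hr
    simp [surfaceRelator, genA, genB, List.finRange_succ])

/-- `cp2HomTwo` on generators. [folklore] -/
@[simp] theorem cp2HomTwo_of (p : surfaceGen 1) :
    cp2HomTwo (PresentedGroup.of p) = if p.2 then (FreeGroup.of 0)⁻¹ else FreeGroup.of 0 :=
  PresentedGroup.toGroup.of _

/-- `cp2HomTwo a = x`. [folklore] -/
@[simp] theorem cp2HomTwo_ta : cp2HomTwo ta = FreeGroup.of 0 := by simp [ta]
/-- `cp2HomTwo b = x⁻¹`. [folklore] -/
@[simp] theorem cp2HomTwo_tb : cp2HomTwo tb = (FreeGroup.of 0)⁻¹ := by simp [tb]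

/-- `⟪ab⟫` dies under `cp2HomTwo`. [folklore] -/
theorem cp2Kernels_two_le_ker : cp2Kernels 2 ≤ cp2HomTwo.ker := by
  rw [cp2Kernels_two]
  exact normalClosure_le_normal (Set.singleton_subset_iff.2 (by simp [MonoidHom.mem_ker]))

/-- `S_1 / ⟪ab⟫ ≅ F_1`. [folklore] -/
def quotientCp2KernelsTwoEquiv : SurfaceGroup 1 ⧸ cp2Kernels 2 ≃* FreeGroup (Fin 1) :=
  MonoidHom.toMulEquiv (QuotientGroup.lift _ cp2HomTwo cp2Kernels_two_le_ker)
    (FreeGroup.lift fun _ => (QuotientGroup.mk ta : SurfaceGroup 1 ⧸ cp2Kernels 2))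
    (by
      apply QuotientGroup.monoidHom_ext
      apply PresentedGroup.ext
      rintro ⟨i, b⟩
      obtain rfl : i = 0 := Subsingleton.elim _ _
      simp only [MonoidHom.comp_apply, MonoidHom.id_apply, QuotientGroup.mk'_apply,
        QuotientGroup.lift_mk]
      cases b
      · rw [cp2HomTwo_ta, FreeGroup.lift_apply_of]
      · rw [cp2HomTwo_tb, map_inv, FreeGroup.lift_apply_of, ← QuotientGroup.mk_inv, QuotientGroup.eq,
          inv_inv]
        exact tab_mem)
    (by
      apply FreeGroup.ext_hom
      intro i
      obtain rfl : i = 0 := Subsingleton.elim _ _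
      simp only [MonoidHom.comp_apply, MonoidHom.id_apply, FreeGroup.lift_apply_of,
        QuotientGroup.lift_mk, cp2HomTwo_ta])

/-- **The genus-one trisection of `ℂP²` is a `(1, 0)` group trisection of the trivial group.** [folklore] -/
theorem cp2Kernels_isGroupTrisection : IsGroupTrisection 1 0 (PUnit : Type) cp2Kernels where
  normal := cp2Kernels_normal
  free_quotient i := by
    rw [isFreeOfRank_quotient_normalClosure_iff]
    fin_cases i
    · exact isFreeOfRank_quotient_cp2Kernels_zero
    · exact isFreeOfRank_quotient_cp2Kernels_one
    · exact ⟨quotientCp2KernelsTwoEquiv.symm⟩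
  free_pairQuotient i j hij := by
    haveI : Subsingleton (cp2Kernels.pairQuotient i j) := by
      refine subsingleton_quotient_of_forall_of_mem _ ?_
      have hsub : ∀ l l' : Fin 3, (cp2Kernels l : Set (SurfaceGroup 1)) ∪ cp2Kernels l' ⊆
          normalClosure ((cp2Kernels l : Set (SurfaceGroup 1)) ∪ cp2Kernels l') :=
        fun _ _ => subset_normalClosure
      have key : ta ∈ normalClosure ((cp2Kernels i : Set (SurfaceGroup 1)) ∪ cp2Kernels j) ∧
          tb ∈ normalClosure ((cp2Kernels i : Set (SurfaceGroup 1)) ∪ cp2Kernels j) := by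
        fin_cases i <;> fin_cases j
        · exact absurd rfl hij
        · exact ⟨hsub _ _ (Or.inl ta_mem), hsub _ _ (Or.inr tb_mem)⟩
        · refine ⟨hsub _ _ (Or.inl ta_mem), ?_⟩
          have h := mul_mem (inv_mem (hsub _ _ (Or.inl ta_mem))) (hsub 0 2 (Or.inr tab_mem))
          rwa [inv_mul_cancel_left] at h
        · exact ⟨hsub _ _ (Or.inr ta_mem), hsub _ _ (Or.inl tb_mem)⟩
        · exact absurd rfl hij
        · refine ⟨?_, hsub _ _ (Or.inl tb_mem)⟩
          have h := mul_mem (hsub 1 2 (Or.inr tab_mem)) (inv_mem (hsub _ _ (Or.inl tb_mem)))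
          rwa [mul_inv_cancel_right] at h
        · refine ⟨hsub _ _ (Or.inr ta_mem), ?_⟩
          have h := mul_mem (inv_mem (hsub _ _ (Or.inr ta_mem))) (hsub 2 0 (Or.inl tab_mem))
          rwa [inv_mul_cancel_left] at h
        · refine ⟨?_, hsub _ _ (Or.inr tb_mem)⟩
          have h := mul_mem (hsub 2 1 (Or.inl tab_mem)) (inv_mem (hsub _ _ (Or.inr tb_mem)))
          rwa [mul_inv_cancel_right] at h
        · exact absurd rfl hij
      rintro ⟨l, c⟩
      obtain rfl : l = 0 := Subsingleton.elim _ _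
      cases c
      · exact key.1
      · exact key.2
    exact isFreeOfRank_zero_of_subsingleton _
  triple := by
    haveI : Subsingleton cp2Kernels.tripleQuotient := by
      refine subsingleton_quotient_of_forall_of_mem _ ?_
      rintro ⟨l, c⟩
      obtain rfl : l = 0 := Subsingleton.elim _ _
      cases c
      · exact subset_normalClosure (Set.mem_iUnion.2 ⟨0, ta_mem⟩)
      · exact subset_normalClosure (Set.mem_iUnion.2 ⟨1, tb_mem⟩)
    letI : Unique cp2Kernels.tripleQuotient := uniqueOfSubsingleton 1
    exact ⟨MulEquiv.ofUnique⟩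

/-- … and it is **not stably trivial**: stabilisation preserves `g - 3k`, here `1 ≠ 0`
(`isStablyTrivial_tight`; concretely the genus equation `3 + 3m = 1 + 3n` has no solution). [folklore] -/
theorem not_isStablyTrivial_cp2Kernels : ¬ cp2Kernels.IsStablyTrivial := fun h => by
  have := (isStablyTrivial_tight cp2Kernels_isGroupTrisection h).1
  omega

/-- **Refuted strengthening I (`g = 3k` is load-bearing in AGK Cor. 6).**  Without the balance
condition, "every group trisection of the trivial group is stably trivial" is false: witness the
`(1,0)` trisection of `ℂP²`.  (So AGK's hypothesis cannot be attacked through any statement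
insensitive to the Euler characteristic `χ = 2 + g - 3k`.) [cite: AbramsGayKirby2018, Cor. 6 (p. 1541)] -/
theorem not_forall_isGroupTrisection_punit_isStablyTrivial :
    ¬ ∀ (g k : ℕ) (K : TrisectionKernels g), IsGroupTrisection g k (PUnit : Type) K → K.IsStablyTrivial :=
  fun h => not_isStablyTrivial_cp2Kernels (h 1 0 cp2Kernels cp2Kernels_isGroupTrisection)

end CP2


end Summit.SmoothPoincare4.SmoothPoincare4.Theorems.AgkCor6Sufficiency.Negative

end
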